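import Summits.HodgeConjecture.HodgeConjecture.Theorems.Ring2AbelianAllAndreNumericalLift
import Summits.HodgeConjecture.HodgeConjecture.Theorems.Ring2AbelianAllAndreHodgeNondegenerate
import Summits.HodgeConjecture.HodgeConjecture.Theorems.Ring2AbelianAllStandardAPencils
import Literature.AlgebraicGeometry.HodgeTheory.AlgebraicClassesCupDivisorHolds
import Literature.AlgebraicGeometry.HodgeTheory.LefschetzOneOneHolds
import HarnessLib

/-!
# Ring 2 · sub-cell AbelianAll (ALL ABELIAN VARIETIES), André axis, part XVIII-d — KLEIMAN'S `A(X, L) ⇒ D(X)` ON THE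
# CARRIERS (via "primitive components of algebraic classes are algebraic" and the second Hodge–Riemann relation),
# hence: `A` of the total space gives conjecture D for fibre-supported cycles, and the Lefschetz-`A` row of the
# André axis `HC_CM ∧ A_pen^CM ⟹ HC_AV` holds WITHOUT the Abdulali named fact `h₈A`

HONEST FRAMING (page 1, verbatim): **research route, not a corollary; conditional on HC_CM plus one named
minimal statement.** Cell line: research route conditional on HC_CM; not a corollary; Q11.4-sentence-2
already refuted in dim ≥ 3. Nothing in this file proves a case of the Hodge conjecture for an abelian variety.
`HC_CM` = `Theses.RankFourFaces.CMAbelianHodge` is a BINDER wherever it occurs; `HC_AV` =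
`Theses.PadicSemiregularLift.HodgeAbelianVarieties`; item `Theses.RankFourFaces.CMToAbelian` (stmt-16267) OPEN and not
closed here. Seat `pub-hodge-ring2-ab-andre-2`, gen 10 (sequel of parts XVIII-a/b; uses seat ab-andre-1's part XIV
nodes `CMPointedPencilStandardA` / `CompactAbelianPencilStandardA` BY NAME).

## The argument (Kleiman 1968 §3 / Grothendieck 1968: `A(X, L)` and `Hdg(X)` give `D(X)`; `Hdg(X)` holds over `ℂ`)

Let `κ` be the rational Kähler class of a Kähler–rational datum `D` of `X` (algebraic by Lefschetz `(1,1)`, a tree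
theorem) and assume `A(X, κ)`: `L^{n-2p} : N^p → N^{n-p}` onto for all `2p ≤ n`. §2 (PRIMITIVE COMPONENTS): every
algebraic `x ∈ N^r` has all its Lefschetz components `ξ_{(a,t)} x ∈ N^{r-t}` algebraic — for `2r ≤ n` by induction on
`r` (`L^{n-2r+1} x ∈ N^{n-r+1} = L^{n-2r+2} N^{r-1}` by `A`, so `x = x₀ + L x₁` with `x₀` primitive algebraic and
`x₁ ∈ N^{r-1}`), for `2r > n` because `x = L^{2r-n} x'` with `x' ∈ N^{n-r}` by `A`. §3: then part XVIII-b's argument runs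
with `N^p`, `N^q` in place of the Hodge spans (`Q_D(conj ξ, ·) = τ(z ∪ ·)` with `z ∈ N^q`; second Hodge–Riemann
relation for classes of pure type `(p,p)`): the cup pairing `N^p × N^q → H^{2n}` is NON-DEGENERATE on both sides —
`D(X)`. The pencil rows (`HC_CM ∧ A_pen^CM ⟹ HC_AV` WITHOUT the Abdulali fact; Abdulali's facts from Lieberman) are in part
XVIII-e; the unconditional codimensions (`p ≤ 2`, `p ≥ n-1`: Lieberman 1968) and their pencil consequences in part XVIII-i.

## What is proved (theorems only; no definition, no named fact, no sorry)

§1 `lefschetzPowTo_mem_supportedClasses`, `exists_lefschetzPowTo_eq_of_standardConjectureA`. §2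
**`primitivePart_mem_supportedClasses_of_standardConjectureA`** (Kleiman: primitive components of algebraic classes are
algebraic under `A`). §3 **`eq_zero_of_forall_cupProduct_algebraic_eq_zero_of_surjOn_lt`** / `…_of_standardConjectureA` (+ `'`),
**`nondegenerate_algebraicClasses_of_standardConjectureA`** (`A(X) ⇒ D(X)` on the carriers). The GRADED forms (`…_of_surjOn_lt`: the surjectivity clause of `A` only below the codimension at hand) are the
ones part XVIII-i instantiates unconditionally.

References: Kleiman1968AlgebraicCycles (§3, Prop. 3.8 / Cor. 3.9); Grothendieck1968 (§3 p. 196); Lieberman1968;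
VoisinHodgeI2002 (§6.2.3 Cor. 6.26, Lemma 6.29, §6.3.2 Thm. 6.32, §7.1.2, Thm. 11.30); Milne2020HodgeClassesAV (Prop. 1,
Rem. 5); Abdulali1994FamiliesAV (p. 1122); Andre1996Motifs (Lemme 6.3.1, §6.3 Remarque 2); Andre2026 (§4.4.1, preprint).
-/

noncomputable section

set_option linter.dupNamespace false

namespace Summit.HodgeConjecture.HodgeConjecture.Ring2.AbelianAll

open CategoryTheory AlgebraicGeometry
open Literature.AlgebraicGeometry Literature.AlgebraicGeometry.Motives
open Literature.AlgebraicGeometry.HodgeTheory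
open Literature.AlgebraicTopology.SingularHomology (singularCohomology cupProduct cupProduct_gradedComm_holds)
open Literature.Geometry.Kaehler (lefschetzOperator lefschetzPow HasHardLefschetzProperty)
open Literature.AlgebraicGeometry.Deligne1982 (cmLocus)
open Literature.AlgebraicGeometry.Andre1996 (andre1996_cmAnchoredPencil)
open Literature.AlgebraicGeometry.Abdulali1994 (InvariantCyclesHoldFor)
open Summit.HodgeConjecture.HodgeConjecture.Theses

section Kleiman

variable {n : ℕ} {X : SchemeOver ℂ}

/-! ## §1 Iterated Lefschetz operators on algebraic classes; `A(X, κ)` with an explicit target degree -/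

/-- `L_κʲ` maps `Nˡ H^{2l}` into `N^{l+j} Hᵐ` (`κ ∈ N¹`; explicit target degree `m = 2l + 2j`).
[cite: VoisinHodgeII2003, §9.2.4 Prop. 9.20] -/
theorem lefschetzPowTo_mem_supportedClasses (hX : IsSmoothProjective n X) {κ : complexBetti X 2}
    (hκ : κ ∈ algebraicClasses X 1) {k l : ℕ} (hk : 2 * l = k) {c : complexBetti X k}
    (hc : c ∈ supportedClasses X k l) (j m : ℕ) (hm : k + 2 * j = m) :
    lefschetzPowTo κ j k m hm c ∈ supportedClasses X m (l + j) := by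
  subst hk
  subst hm
  rw [lefschetzPowTo_eq_lefschetzPow]
  exact lefschetzPow_mem_supportedClasses_of_mem hX hκ l hc j

/-- Surjectivity of `Lʳ : Nᵖ → N^{p+r}` with an explicit target degree `m = 2p + 2r`.
[cite: Grothendieck1968, §3 p. 196 (A(X))] -/
theorem exists_lefschetzPowTo_eq_of_surjOn {κ : complexBetti X 2} {p r m : ℕ}
    (h : Set.SurjOn (lefschetzPow κ r (2 * p)) (algebraicClasses X p : Set (complexBetti X (2 * p)))
      (supportedClasses X (2 * p + 2 * r) (p + r)))
    (hm : 2 * p + 2 * r = m) {y : complexBetti X m} (hy : y ∈ supportedClasses X m (p + r)) :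
    ∃ x ∈ algebraicClasses X p, lefschetzPowTo κ r (2 * p) m hm x = y := by
  subst hm
  obtain ⟨x, hx, hxy⟩ := h hy
  exact ⟨x, hx, hxy⟩

/-- `A(X, κ)`, surjectivity clause, with an explicit target degree: for `2p + r = n` and `2p + 2r = m`, every class of
`N^{p+r} Hᵐ` is `Lʳ x` with `x ∈ Nᵖ`. [cite: Grothendieck1968, §3 p. 196 (A(X))] -/
theorem exists_lefschetzPowTo_eq_of_standardConjectureA {κ : complexBetti X 2} (hA : StandardConjectureA n X κ)
    {p r m : ℕ} (hpr : 2 * p + r = n) (hm : 2 * p + 2 * r = m) {y : complexBetti X m}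
    (hy : y ∈ supportedClasses X m (p + r)) :
    ∃ x ∈ algebraicClasses X p, lefschetzPowTo κ r (2 * p) m hm x = y :=
  exists_lefschetzPowTo_eq_of_surjOn (hA.2 p r (p + r) hpr rfl).surjOn hm hy

/-! ## §2 Kleiman: under `A(X, κ)` the primitive components of algebraic classes are algebraic -/

/-- **Shift step.** If every Lefschetz component `ξ_Q x''` of `x'' ∈ H^{i''}` is algebraic of codimension `r'' - t_Q`,
and `a_Q + t_Q + e ≤ n` for all indices `Q`, then every Lefschetz component of `Lᵉ x''` is algebraic of codimension
`r'' + e - t` (the components of `Lᵉ x''` are those of `x''`, shifted: uniqueness of the Lefschetz decomposition).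
[cite: VoisinHodgeI2002, §6.2.3 Cor. 6.26] -/
theorem primitivePart_lefschetzPowTo_mem_supportedClasses {κ : complexBetti X 2} (hL : HasHardLefschetzProperty κ n)
    (hvan : ∀ m, 2 * n < m → Subsingleton (complexBetti X m)) {i'' i e r'' : ℕ} (hi : i'' + 2 * e = i)
    {x'' : complexBetti X i''}
    (hx'' : ∀ Q : {Q : ℕ × ℕ // Q.1 + 2 * Q.2 = i''},
      primitivePart κ n hL hvan Q x'' ∈ supportedClasses X Q.1.1 (r'' - Q.1.2))
    (he : ∀ Q : {Q : ℕ × ℕ // Q.1 + 2 * Q.2 = i''}, Q.1.1 + Q.1.2 + e ≤ n)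
    (P : {P : ℕ × ℕ // P.1 + 2 * P.2 = i}) :
    primitivePart κ n hL hvan P (lefschetzPowTo κ e i'' i hi x'') ∈ supportedClasses X P.1.1 (r'' + e - P.1.2) := by
  classical
  -- `Lᵉ x'' = Σ_Q L^{t_Q + e} ξ_Q x''`
  have hsum : lefschetzPowTo κ e i'' i hi x'' =
      ∑ Q : {Q : ℕ × ℕ // Q.1 + 2 * Q.2 = i''},
        lefschetzPowTo κ (Q.1.2 + e) Q.1.1 i (by have := Q.2; omega) (primitivePart κ n hL hvan Q x'') := by
    conv_lhs => rw [← sum_lefschetzPowTo_primitivePart hL hvan x'']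
    rw [map_sum]
    refine Finset.sum_congr rfl fun Q _ ↦ ?_
    exact lefschetzPowTo_lefschetzPowTo κ e Q.2 hi _ _
  rw [hsum, map_sum]
  refine Submodule.sum_mem _ fun Q _ ↦ ?_
  have hQ2 := Q.2
  have hPQ2 : Q.1.1 + 2 * (Q.1.2 + e) = i := by omega
  have hmem : lefschetzPowTo κ (Q.1.2 + e) Q.1.1 i hPQ2 (primitivePart κ n hL hvan Q x'') ∈
      lefschetzSummand κ n i ⟨(Q.1.1, Q.1.2 + e), hPQ2⟩ :=
    lefschetzPowTo_mem_lefschetzSummand hPQ2 (primitivePart_mem hL hvan Q x'')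
  by_cases hP : P = ⟨(Q.1.1, Q.1.2 + e), hPQ2⟩
  · subst hP
    rw [primitivePart_lefschetzPowTo_of_mem hL hvan ⟨(Q.1.1, Q.1.2 + e), hPQ2⟩
      (by have := he Q; dsimp only; omega) (primitivePart_mem hL hvan Q x'')]
    change primitivePart κ n hL hvan Q x'' ∈ supportedClasses X Q.1.1 (r'' + e - (Q.1.2 + e))
    rw [show r'' + e - (Q.1.2 + e) = r'' - Q.1.2 by omega]
    exact hx'' Q
  · rw [primitivePart_eq_zero_of_mem_ne hL hvan (fun h ↦ hP h.symm) hmem]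
    exact Submodule.zero_mem _

/-- **KLEIMAN, GRADED: THE PRIMITIVE COMPONENTS OF AN ALGEBRAIC CLASS OF CODIMENSION `r` ARE ALGEBRAIC as soon as the
surjectivity clause of `A(X, κ)` holds in the codimensions `p' < r` with `p' + r ≤ n`** (so UNCONDITIONALLY for `r ≤ 2` and for
`r ≥ n - 1`, where only `p' ≤ 1` is asked — Lefschetz `(1,1)` —, part XVIII-i). For `X` smooth projective of dimension `n`
and `κ ∈ N¹ H²(X(ℂ); ℂ)` with the hard Lefschetz property, every algebraic class `x ∈ Nʳ H^{2r}` then has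
`ξ_{(a,t)} x ∈ N^{r-t} Hᵃ` for every Lefschetz index `(a, t)`, `a + 2t = 2r`. (For `2r ≤ n`: `L^{n-2r+1} x ∈
N^{n-r+1} = L^{n-2r+2} N^{r-1}` by `A`, so `x = x₀ + L x₁`, `x₀` primitive algebraic, `x₁ ∈ N^{r-1}`, and induct; for
`2r > n`: `x = L^{2r-n} x'`, `x' ∈ N^{n-r}`, by `A`.) [cite: Kleiman1968AlgebraicCycles, §3 (proof of Prop. 3.8)]
[cite: Grothendieck1968, §3 p. 196] [cite: VoisinHodgeI2002, §6.2.3 Cor. 6.26] -/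
theorem primitivePart_mem_supportedClasses_of_surjOn_lt (hX : IsSmoothProjective n X) {κ : complexBetti X 2}
    (hκ : κ ∈ algebraicClasses X 1) (hL : HasHardLefschetzProperty κ n)
    (hvan : ∀ m, 2 * n < m → Subsingleton (complexBetti X m)) :
    ∀ (r : ℕ), (∀ (p' r' q' : ℕ), p' < r → p' + r ≤ n → 2 * p' + r' = n → p' + r' = q' →
        Set.SurjOn (lefschetzPow κ r' (2 * p')) (algebraicClasses X p' : Set (complexBetti X (2 * p')))
          (supportedClasses X (2 * p' + 2 * r') q')) →
      ∀ (x : complexBetti X (2 * r)), x ∈ algebraicClasses X r →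
      ∀ P : {P : ℕ × ℕ // P.1 + 2 * P.2 = 2 * r},
        primitivePart κ n hL hvan P x ∈ supportedClasses X P.1.1 (r - P.1.2) := by
  classical
  intro r
  induction r using Nat.strong_induction_on with
  | _ r ih =>
  intro hA x hx P
  have hP2 := P.2
  rcases le_or_gt (2 * r) n with hr | hr
  · -- degrees `2r ≤ n`
    rcases Nat.eq_zero_or_pos r with rfl | hr0
    · -- `r = 0`: `x` is primitive of degree `0` and `P = (0, 0)`
      obtain ⟨⟨a, t⟩, hat⟩ := P
      have ha : a = 0 := by omega
      have ht : t = 0 := by omega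
      subst ha; subst ht
      have hprim : x ∈ primitiveClasses κ n (2 * 0) := by
        rw [primitiveClasses_eq_ker κ n (by omega) (show 2 * 0 + (n + 1) = n + 1 by omega)
          (show 2 * 0 + 2 * (n + 1) = 2 * n + 2 by ring), LinearMap.mem_ker]
        haveI := hvan (2 * n + 2) (by omega)
        exact Subsingleton.elim _ _
      have h := primitivePart_lefschetzPowTo_of_mem hL hvan ⟨(2 * 0, 0), hat⟩ (by norm_num) hprim
      rw [lefschetzPowTo_zero_eq_id κ, LinearMap.id_apply] at h
      rw [h]
      exact hx
    · -- `r = r₀ + 1`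
      obtain ⟨r₀, rfl⟩ : ∃ r₀, r = r₀ + 1 := ⟨r - 1, by omega⟩
      -- `y = L^{n-2r+1} x ∈ N^{n-r₀}`, `= L^{n-2r₀} x₁` with `x₁ ∈ N^{r₀}` by `A`
      set e' := n - 2 * r₀ - 1 with he'
      have hy := lefschetzPowTo_mem_supportedClasses hX hκ rfl hx e' (2 * r₀ + 2 * (1 + e')) (by omega)
      obtain ⟨x₁, hx₁, hx₁y⟩ := exists_lefschetzPowTo_eq_of_surjOn
        (hA r₀ (1 + e') (r₀ + (1 + e')) (by omega) (by omega) (by omega) rfl) rfl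
        (by rw [show r₀ + (1 + e') = r₀ + 1 + e' by ring]; exact hy)
      -- `x₀ := x - L x₁` is primitive and algebraic
      set x₀ := x - lefschetzPowTo κ 1 (2 * r₀) (2 * (r₀ + 1)) (by ring) x₁ with hx₀
      have hx₀alg : x₀ ∈ algebraicClasses X (r₀ + 1) :=
        Submodule.sub_mem _ hx (lefschetzPowTo_mem_supportedClasses hX hκ rfl hx₁ 1 _ (by ring))
      have hx₀prim : x₀ ∈ primitiveClasses κ n (2 * (r₀ + 1)) := by
        rw [primitiveClasses_eq_ker κ n hr (show 2 * (r₀ + 1) + e' = n + 1 by omega)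
          (show 2 * (r₀ + 1) + 2 * e' = 2 * r₀ + 2 * (1 + e') by omega), LinearMap.mem_ker, hx₀, map_sub,
          lefschetzPowTo_lefschetzPowTo κ e' (show 2 * r₀ + 2 * 1 = 2 * (r₀ + 1) by ring)
            (show 2 * (r₀ + 1) + 2 * e' = 2 * r₀ + 2 * (1 + e') by omega) (show 2 * r₀ + 2 * (1 + e') = 2 * r₀ + 2 * (1 + e') from rfl) x₁,
          hx₁y, sub_self]
      -- decompose `ξ_P x = ξ_P x₀ + ξ_P (L x₁)`
      have hxdec : x = x₀ + lefschetzPowTo κ 1 (2 * r₀) (2 * (r₀ + 1)) (by ring) x₁ := by rw [hx₀]; abel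
      rw [hxdec, map_add]
      refine Submodule.add_mem _ ?_ ?_
      · -- the primitive term
        have hP₀2 : 2 * (r₀ + 1) + 2 * 0 = 2 * (r₀ + 1) := by ring
        have hmem : x₀ ∈ lefschetzSummand κ n (2 * (r₀ + 1)) ⟨(2 * (r₀ + 1), 0), hP₀2⟩ := by
          have h := lefschetzPowTo_mem_lefschetzSummand (κ := κ) (n := n) hP₀2 hx₀prim
          rwa [lefschetzPowTo_zero_eq_id κ, LinearMap.id_apply] at h
        by_cases hP : P = ⟨(2 * (r₀ + 1), 0), hP₀2⟩
        · subst hP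
          have h := primitivePart_lefschetzPowTo_of_mem hL hvan ⟨(2 * (r₀ + 1), 0), hP₀2⟩
            (by change 2 * (r₀ + 1) + 0 ≤ n; omega) hx₀prim
          rw [lefschetzPowTo_zero_eq_id κ, LinearMap.id_apply] at h
          rw [h]
          change x₀ ∈ supportedClasses X (2 * (r₀ + 1)) (r₀ + 1 - 0)
          exact hx₀alg
        · rw [primitivePart_eq_zero_of_mem_ne hL hvan (fun h ↦ hP h.symm) hmem]
          exact Submodule.zero_mem _
      · -- the shifted components of `x₁` (induction hypothesis in degree `2r₀`)
        have hA₀ : ∀ (p' r' q' : ℕ), p' < r₀ → p' + r₀ ≤ n → 2 * p' + r' = n → p' + r' = q' →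
            Set.SurjOn (lefschetzPow κ r' (2 * p')) (algebraicClasses X p' : Set (complexBetti X (2 * p')))
              (supportedClasses X (2 * p' + 2 * r') q') :=
          fun p' r' q' h1 h2 h3 h4 ↦ hA p' r' q' (by omega) (by omega) h3 h4
        have h := primitivePart_lefschetzPowTo_mem_supportedClasses hL hvan (i'' := 2 * r₀) (e := 1) (r'' := r₀)
          (by ring) (fun Q ↦ ih r₀ (by omega) hA₀ x₁ hx₁ Q) (fun Q ↦ by have := Q.2; omega) P
        rwa [show r₀ + 1 - P.1.2 = r₀ + 1 - P.1.2 from rfl] at h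
  · -- degrees `2r > n`
    rcases le_or_gt (2 * r) (2 * n) with hr2 | hr2
    · -- `x = L^{2r-n} x'` with `x' ∈ N^{n-r}` by `A`
      obtain ⟨x', hx', hx'x⟩ := exists_lefschetzPowTo_eq_of_surjOn
        (hA (n - r) (2 * r - n) (n - r + (2 * r - n)) (by omega) (by omega) (by omega) rfl)
        (m := 2 * r) (by omega) (y := x) (by rw [show n - r + (2 * r - n) = r by omega]; exact hx)
      rw [← hx'x]
      have hA' : ∀ (p' r' q' : ℕ), p' < n - r → p' + (n - r) ≤ n → 2 * p' + r' = n → p' + r' = q' →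
          Set.SurjOn (lefschetzPow κ r' (2 * p')) (algebraicClasses X p' : Set (complexBetti X (2 * p')))
            (supportedClasses X (2 * p' + 2 * r') q') :=
        fun p' r' q' h1 h2 h3 h4 ↦ hA p' r' q' (by omega) (by omega) h3 h4
      have h := primitivePart_lefschetzPowTo_mem_supportedClasses hL hvan (i'' := 2 * (n - r)) (e := 2 * r - n)
        (r'' := n - r) (by omega) (fun Q ↦ ih (n - r) (by omega) hA' x' hx' Q) (fun Q ↦ by have := Q.2; omega) P
      rwa [show n - r + (2 * r - n) - P.1.2 = r - P.1.2 by omega] at h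
    · -- `2r > 2n`: the cohomology vanishes
      haveI := hvan (2 * r) hr2
      rw [Subsingleton.elim x 0, map_zero]
      exact Submodule.zero_mem _

/-- **KLEIMAN: UNDER `A(X, κ)` THE PRIMITIVE COMPONENTS OF ALGEBRAIC CLASSES ARE ALGEBRAIC** (all codimensions).
[cite: Kleiman1968AlgebraicCycles, §3 (proof of Prop. 3.8)] [cite: Grothendieck1968, §3 p. 196] -/
theorem primitivePart_mem_supportedClasses_of_standardConjectureA (hX : IsSmoothProjective n X) {κ : complexBetti X 2}
    (hκ : κ ∈ algebraicClasses X 1) (hL : HasHardLefschetzProperty κ n)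
    (hvan : ∀ m, 2 * n < m → Subsingleton (complexBetti X m)) (hA : StandardConjectureA n X κ) (r : ℕ)
    (x : complexBetti X (2 * r)) (hx : x ∈ algebraicClasses X r) (P : {P : ℕ × ℕ // P.1 + 2 * P.2 = 2 * r}) :
    primitivePart κ n hL hvan P x ∈ supportedClasses X P.1.1 (r - P.1.2) :=
  primitivePart_mem_supportedClasses_of_surjOn_lt hX hκ hL hvan r
    (fun p' r' q' _ _ h3 h4 ↦ (hA.2 p' r' q' h3 h4).surjOn) x hx P

/-! ## §3 `A(X, κ) ⇒ D(X)`: non-degeneracy of the cup pairing on algebraic classes -/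

/-- `N^p` is stable under complex conjugation (it is spanned by rational classes — Grothendieck 1969, the tree's
`supportedClasses_le_span_isRationalClass` — and rational classes are real). [cite: GrothendieckTopology1969, §1]
[cite: VoisinHodgeI2002, Cor. 6.12] -/
theorem conjClass_mem_algebraicClasses (hX : IsSmoothProjective n X) (p : ℕ) {c : complexBetti X (2 * p)}
    (hc : c ∈ algebraicClasses X p) : conjClass (ComplexPoints X) (2 * p) c ∈ algebraicClasses X p := by
  have hc' := supportedClasses_le_span_isRationalClass hX (2 * p) p hc
  clear hc
  induction hc' using Submodule.span_induction with
  | mem c hmem => rw [hmem.1.conjClass_eq]; exact hmem.2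
  | zero => rw [conjClass_zero]; exact Submodule.zero_mem _
  | add c c' _ _ ihc ihc' => rw [conjClass_add]; exact Submodule.add_mem _ ihc ihc'
  | smul a c _ ihc => rw [conjClass_smul]; exact Submodule.smul_mem _ _ ihc

/-- The Kähler class of a Kähler–rational datum is algebraic (rational of type `(1,1)`: Lefschetz `(1,1)`, a tree
theorem) — so it is a polarisation class in the tree's sense. [cite: VoisinHodgeI2002, Thm. 11.30 and §7.1.2] -/
theorem isPolarizationClass_Hη (hX : IsSmoothProjective n X) (D : KaehlerRationalDatum n X) :
    IsPolarizationClass n X D.Hη :=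
  ⟨D.isRationalClass_Hη, lefschetzOneOne_rational_holds hX _ D.isRationalClass_Hη D.isOfHodgeType_Hη,
    D.hasHardLefschetzProperty hX⟩

/-- Granted the surjectivity clause of `A(X, κ)` in the codimensions `p' < p`, `p' + p ≤ n` (`κ` the class of a
Kähler–rational datum), the Lefschetz terms `L^{s'} ξ_P x` of an algebraic class `x ∈ N^p` are algebraic of codimension
`q = n - p` (§2 and §1). [cite: Kleiman1968AlgebraicCycles, §3] -/
theorem lefschetzPowTo_primitivePart_mem_algebraicClasses_of_surjOn_lt (hX : IsSmoothProjective n X)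
    (D : KaehlerRationalDatum n X) {p q : ℕ} (hpq : p + q = n)
    (hA : ∀ (p' r' q' : ℕ), p' < p → p' + p ≤ n → 2 * p' + r' = n → p' + r' = q' →
      Set.SurjOn (lefschetzPow D.Hη r' (2 * p')) (algebraicClasses X p' : Set (complexBetti X (2 * p')))
        (supportedClasses X (2 * p' + 2 * r') q'))
    {x : complexBetti X (2 * p)} (hx : x ∈ algebraicClasses X p) (P : {P : ℕ × ℕ // P.1 + 2 * P.2 = 2 * p}) (s' : ℕ)
    (hs' : P.1.1 + P.1.2 + s' = n) (hq : P.1.1 + 2 * s' = 2 * q) :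
    lefschetzPowTo D.Hη s' P.1.1 (2 * q) hq (primitivePart D.Hη n (D.hLℂ hX) (subsingleton_of_lt hX ℂ) P x) ∈
      algebraicClasses X q := by
  have hP2 := P.2
  have hκ := (isPolarizationClass_Hη hX D).mem_algebraicClasses
  have hξ := primitivePart_mem_supportedClasses_of_surjOn_lt hX hκ (D.hLℂ hX) (subsingleton_of_lt hX ℂ) p hA x hx P
  have h := lefschetzPowTo_mem_supportedClasses hX hκ (show 2 * (p - P.1.2) = P.1.1 by omega) hξ s' (2 * q) hq
  rwa [show p - P.1.2 + s' = q by omega] at h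

/-- **"HOM ≡ NUM", LEFT, IN CODIMENSION `p`, GRANTED `A` BELOW `p`**: for `X` smooth projective of dimension `n`, `p + q = n`,
and `κ` the class of a Kähler–rational datum `D` with the surjectivity clause of `A(X, κ)` in the codimensions `p' < p`,
`p' + p ≤ n`: an algebraic class `ξ ∈ N^p(X)` cup-orthogonal to `N^q(X)` vanishes — part XVIII-b's argument with `N` in
place of the Hodge spans (`Q_D(conj ξ, ·) = τ(z ∪ ·)` with `z ∈ N^q` by §2; second Hodge–Riemann relation for classes of
pure type `(p,p)`). Kleiman's `A(X) ∧ Hdg(X) ⇒ D(X)`, graded. [cite: Kleiman1968AlgebraicCycles, §3 Prop. 3.8 and Cor. 3.9]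
[cite: VoisinHodgeI2002, §6.3.2 Thm. 6.32] -/
theorem eq_zero_of_forall_cupProduct_algebraic_eq_zero_of_surjOn_lt (hX : IsSmoothProjective n X)
    (D : KaehlerRationalDatum n X) {p q : ℕ} (hpq : p + q = n)
    (hA : ∀ (p' r' q' : ℕ), p' < p → p' + p ≤ n → 2 * p' + r' = n → p' + r' = q' →
      Set.SurjOn (lefschetzPow D.Hη r' (2 * p')) (algebraicClasses X p' : Set (complexBetti X (2 * p')))
        (supportedClasses X (2 * p' + 2 * r') q'))
    {ξ : complexBetti X (2 * p)} (hξ : ξ ∈ algebraicClasses X p)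
    (h : ∀ b ∈ algebraicClasses X q, cupProduct (show 2 * p + 2 * q = 2 * n by omega) ξ b = 0) : ξ = 0 := by
  obtain ⟨A⟩ := nonempty_hodgeModel_holds hX
  have hI := hodgePQ_independent_of_hodgeModel_holds
  set x := conjClass (ComplexPoints X) (2 * p) ξ with hxdef
  have hx : x ∈ algebraicClasses X p := conjClass_mem_algebraicClasses hX p hξ
  obtain ⟨z, hz, hQ⟩ := exists_polarizationForm_eq_trace_cupProduct (D.hLℂ hX) (subsingleton_of_lt hX ℂ)
    (D.cTrace hX) (show 2 * q + 2 * p = 2 * n by omega) x _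
    (fun P s' hs' hq ↦ lefschetzPowTo_primitivePart_mem_algebraicClasses_of_surjOn_lt hX D hpq hA hx P s' hs' hq)
  have h0 : D.cform hX (2 * p) x (conjClass (ComplexPoints X) (2 * p) x) = 0 := by
    rw [hxdef, conjClass_conjClass ξ, ← hxdef, KaehlerRationalDatum.cform, hQ,
      cupProduct_gradedComm_holds ℂ (ComplexPoints X) (show 2 * q + 2 * p = 2 * n by omega)
        (show 2 * p + 2 * q = 2 * n by omega) z ξ, h z hz, smul_zero, map_zero]
  by_contra hξ0
  have hx0 : x ≠ 0 := by
    intro hx0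
    apply hξ0
    rw [← conjClass_conjClass ξ, ← hxdef, hx0, conjClass_zero]
  have hpp : (p, p) ∈ Finset.HasAntidiagonal.antidiagonal (2 * p) := Finset.HasAntidiagonal.mem_antidiagonal.2 (by omega)
  have hxA : x ∈ A.typePiece (2 * p) ⟨(p, p), hpp⟩ :=
    A.mem_typePiece_of_isOfHodgeType hI hX hpp (isOfHodgeType_of_mem_algebraicClasses_of_isSmoothProjective hX p hx)
  obtain ⟨r, hr, hQr⟩ := D.cform_conj_pos hX A hpp hxA hx0
  rw [h0, mul_zero] at hQr
  exact hr.ne' (by exact_mod_cast hQr.symm)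

/-- **`A(X, κ) ⇒ D(X)`, LEFT: for `ξ ∈ N^p(X)` cup-orthogonal to `N^q(X)` (`p + q = n`), `ξ = 0`.**
[cite: Kleiman1968AlgebraicCycles, §3 Prop. 3.8 and Cor. 3.9] [cite: VoisinHodgeI2002, §6.3.2 Thm. 6.32] -/
theorem eq_zero_of_forall_cupProduct_algebraic_eq_zero_of_standardConjectureA (hX : IsSmoothProjective n X)
    (D : KaehlerRationalDatum n X) (hA : StandardConjectureA n X D.Hη) {p q : ℕ} (hpq : p + q = n)
    {ξ : complexBetti X (2 * p)} (hξ : ξ ∈ algebraicClasses X p)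
    (h : ∀ b ∈ algebraicClasses X q, cupProduct (show 2 * p + 2 * q = 2 * n by omega) ξ b = 0) : ξ = 0 :=
  eq_zero_of_forall_cupProduct_algebraic_eq_zero_of_surjOn_lt hX D hpq
    (fun p' r' q' _ _ h3 h4 ↦ (hA.2 p' r' q' h3 h4).surjOn) hξ h

/-- **`A(X, κ) ⇒ D(X)`, RIGHT** (exchange `p`, `q`; graded commutativity in even degrees).
[cite: Kleiman1968AlgebraicCycles, §3 Prop. 3.8 and Cor. 3.9] -/
theorem eq_zero_of_forall_cupProduct_algebraic_eq_zero_of_standardConjectureA' (hX : IsSmoothProjective n X)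
    (D : KaehlerRationalDatum n X) (hA : StandardConjectureA n X D.Hη) {p q : ℕ} (hpq : p + q = n)
    {b : complexBetti X (2 * q)} (hb : b ∈ algebraicClasses X q)
    (h0 : ∀ ξ ∈ algebraicClasses X p, cupProduct (show 2 * p + 2 * q = 2 * n by omega) ξ b = 0) : b = 0 := by
  refine eq_zero_of_forall_cupProduct_algebraic_eq_zero_of_standardConjectureA hX D hA (show q + p = n by omega) hb
    fun ξ hξ ↦ ?_
  rw [cupProduct_gradedComm_holds ℂ (ComplexPoints X) (show 2 * q + 2 * p = 2 * n by omega)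
    (show 2 * p + 2 * q = 2 * n by omega) b ξ, h0 ξ hξ, smul_zero]

/-- **`A(X, η)` FOR ALL POLARISATION CLASSES `⇒ D(X)`: the cup pairing `N^p(X) × N^q(X) → H^{2n}(X(ℂ); ℂ)` (`p + q = n`)
is non-degenerate on both sides** (take `η` the Kähler class of a Kähler–rational datum, a polarisation class by
Lefschetz `(1,1)`). This is (Perf) of part XVIII-a for `X` a fibre, and — on a total space — the source of (Num).
[cite: Kleiman1968AlgebraicCycles, §3 Prop. 3.8 and Cor. 3.9] [cite: Grothendieck1968, §3 p. 196] -/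
theorem nondegenerate_algebraicClasses_of_standardConjectureA (hX : IsSmoothProjective n X)
    (hA : ∀ η : complexBetti X 2, IsPolarizationClass n X η → StandardConjectureA n X η) {p q : ℕ} (hpq : p + q = n) :
    (∀ ξ ∈ algebraicClasses X p,
        (∀ b ∈ algebraicClasses X q, cupProduct (show 2 * p + 2 * q = 2 * n by omega) ξ b = 0) → ξ = 0) ∧
      (∀ b ∈ algebraicClasses X q,
        (∀ ξ ∈ algebraicClasses X p, cupProduct (show 2 * p + 2 * q = 2 * n by omega) ξ b = 0) → b = 0) := by
  obtain ⟨D⟩ := nonempty_kaehlerRationalDatum hX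
  have hA' := hA _ (isPolarizationClass_Hη hX D)
  exact ⟨fun ξ hξ h ↦ eq_zero_of_forall_cupProduct_algebraic_eq_zero_of_standardConjectureA hX D hA' hpq hξ h,
    fun b hb h ↦ eq_zero_of_forall_cupProduct_algebraic_eq_zero_of_standardConjectureA' hX D hA' hpq hb h⟩

end Kleiman

end Summit.HodgeConjecture.HodgeConjecture.Ring2.AbelianAll

end
-- buildfix (ops-buildfix lane, 2026-08-20): comment-only re-land to enqueue the hub build after the Milne1999/CM chain repair (LEDGER C-7); no declaration changed.
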